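import Summits.KontsevichZagierPeriods.KontsevichZagierPeriods.Theses.DefinableMoves
import Summits.KontsevichZagierPeriods.KontsevichZagierPeriods.Theorems.VietaFibreKernelFormItemDictionary
import Literature.NumberTheory.Transcendental.KZProductIdeal
import Literature.NumberTheory.Transcendental.KZKernelConjectureForms

/-!
# The π-split of `RealKZ` over `ℝ` — CRUX WORKFILE copy (route DefinableMoves; crux stmt-KontsevichZagierPeriods-4085)

This is `Theorems/DefinableMovesRealKZPiSplit.lean` (attached as evidence on the item, to be landed by a prover
`--supports stmt-KontsevichZagierPeriods-4085`; planners cannot write under Theorems) under the namespace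
`…Cruxes.RealKZ.PiSplit`, plus the section "the pieces are consequences of the summit" at the end.

GLUE of the strategist's decomposition (BC2 redirect) of the deciding crux `DefinableMoves.RealKZ`
(Conjecture 1 of Kontsevich–Zagier with REAL-semialgebraic intermediate data, `ℚ`-rational endpoints)
into

* `DefinableMoves.AyoubPiLocalKernel` — item stmt-KontsevichZagierPeriods-0541 verbatim (shared with
  route AyoubSpecialisation): the `π`-LOCAL KERNEL of KZ's calculus, Conjecture 1 for the effective
  period ring localised at `[π]` [Kontsevich–Zagier 2001, §4.1; Ayoub 2014, Def. 6 / Conj. 7];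
* `DefinableMoves.RealPiCancellation` — item stmt-KontsevichZagierPeriods-17880 (new): REAL
  `π`-CANCELLATION: for a formal `ℤ`-combination `c` of KZ representations, if the real base change of
  `[π] * c` (`KZ.piRep`, the product of `KZProduct.lean`) is a relation of the real-coefficient calculus
  `KZ_ℝ = KZOver ℝ`, then so is the real base change of `c`.

Main results (all sorry-free):

* `realKZ_of_piSplit : AyoubPiLocalKernel → RealPiCancellation → RealKZ` — THE GLUE. Proof: item 0541
  is `KZ.PiLocalKernel` (tree dictionary `KernelForm.LocaliseAtValuePrime.ayoubPiLocalKernel_iff_piLocalKernel`);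
  a `ℚ`-certificate for `([π] * ·)^[N] c` is base-changed into `KZOver.relations ℝ`
  (`KZOver.baseChange_mem_relations ∘ KZOver.equivKZ`); the `N` factors `[π]` are peeled over `ℝ` by
  `RealPiCancellation` (induction on `N`); and the real kernel form is turned into `RealKZ`'s inline raw
  calculus by `KZOver.Raw.gen_sub_gen_mem_Rel_iff_kz`.
* `realKZ_iff_realKernelForm : RealKZ ↔ RealKernelForm` (`∀ c, KZ.eval c = 0 → bc c ∈ KZOver.relations ℝ`),
  the converse using `KZ.exists_integralRep_sub`, `KZ.exists_isRational_equivalent` and soundness.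
* Calibration: `realPiCancellation_of_realKZ : RealKZ → RealPiCancellation` (the new piece is a
  consequence of the crux); `realPiCancellation_iff_pinned` (the item in the pinned interface typing of
  items 0540/0541); `realPiCancellation_iff_piCancellation_of_transfer : Transfer →
  (RealPiCancellation ↔ KZ.PiCancellation)` and `…_iff_ayoubPiCancellation_of_transfer` — GIVEN the
  route's crux `Transfer` (item 4088) the new piece is exactly item 0540; today the two are incomparable.
  `realKernelForm_iff_kernel_of_transfer : Transfer → (RealKernelForm ↔ KZKernelConjecture)`.

What is NOT here: any claim about the pieces themselves (both open, conjecture-grade), and no theorem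
with the summit statement as hypothesis (those live in `Cruxes/RealKZ/PiSplit.lean`).

Sources: M. Kontsevich, D. Zagier, *Periods* (2001), §1.2 Conjecture 1, §4.1 (`P̂ = P[(2πi)⁻¹]`);
J. Ayoub, *Periods and the conjectures of Grothendieck and Kontsevich–Zagier*, EMS Newsl. 91 (2014),
Def. 6 / Conj. 7; A. Huber, G. Wüstholz, *Transcendence and linear relations of 1-periods* (2022),
App. A.3–A.4; J. Cresson, J. Viu-Sos, JTNB 34 (2022), §1.
-/

noncomputable section

open Literature.NumberTheory.Transcendental
open Summit.KontsevichZagierPeriods.KontsevichZagierPeriods.Theses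
open Summit.KontsevichZagierPeriods.KontsevichZagierPeriods.Theses.DefinableMoves

namespace Summit.KontsevichZagierPeriods.KontsevichZagierPeriods.Cruxes.RealKZ.PiSplit

/-- The item `RealPiCancellation` in the PINNED interface typing of items 0540/0541 (auxiliary): for
every family `P n r : IntegralRep (n + 2)` pinned as "closed unit disc in the two leading coordinates,
`r` in the trailing `n`". [folklore] -/
def RealPiCancellationPinned : Prop :=
  ∀ (P : ∀ n : ℕ, KZ.IntegralRep n → KZ.IntegralRep (n + 2)), (∀ (n : ℕ) (r : KZ.IntegralRep n), (P n r).domain = {z : Fin (n + 2) → ℝ | z 0 ^ 2 + z 1 ^ 2 ≤ 1 ∧ (fun i : Fin n => z i.succ.succ) ∈ r.domain} ∧ (P n r).integrand = fun z => r.integrand (fun i : Fin n => z i.succ.succ)) → ∀ c : KZ.FormalRep, KZOver.baseChange ℚ ℝ (KZOver.equivKZ (FreeAbelianGroup.lift (fun s : (Σ n, KZ.IntegralRep n) => KZ.of (P s.1 s.2)) c)) ∈ KZOver.relations ℝ → KZOver.baseChange ℚ ℝ (KZOver.equivKZ c) ∈ KZOver.relations ℝ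

/-- The REAL KERNEL FORM of `RealKZ` (auxiliary): every formal `ℤ`-combination of KZ representations
with value `0` becomes a relation of `KZ_ℝ` after real base change. [folklore] -/
def RealKernelForm : Prop :=
  ∀ c : KZ.FormalRep, KZ.eval c = 0 → KZOver.baseChange ℚ ℝ (KZOver.equivKZ c) ∈ KZOver.relations ℝ

/-! ### Bookkeeping: the real base change `bc = baseChange ℚ ℝ ∘ equivKZ : KZ.FormalRep →+ KZOver.FormalRep ℝ` -/

/-- The real base change of formal combinations, bundled. [folklore] -/
def bc : KZ.FormalRep →+ KZOver.FormalRep ℝ :=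
  (KZOver.baseChange ℚ ℝ).comp KZOver.equivKZ.toAddMonoidHom

@[simp] theorem bc_apply (c : KZ.FormalRep) :
    bc c = KZOver.baseChange ℚ ℝ (KZOver.equivKZ c) := rfl

/-- `bc` on a generator is the generator of the real base change. [folklore] -/
theorem bc_of {n : ℕ} (r : KZ.IntegralRep n) :
    bc (KZ.of r) = KZOver.of (KZOver.IntegralRep.ofKZOver ℝ r) := rfl

/-- `ℚ`-relations are `ℝ`-relations after base change. [folklore] -/
theorem bc_mem_relations {c : KZ.FormalRep} (hc : c ∈ KZ.relations) :
    bc c ∈ KZOver.relations ℝ :=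
  KZOver.baseChange_mem_relations ℝ ((KZOver.equivKZ_mem_relations_iff c).mpr hc)

/-- Base change commutes with evaluation. [folklore] -/
theorem eval_bc (c : KZ.FormalRep) : KZOver.eval ℝ (bc c) = KZ.eval c := by
  simp [bc]

/-- `toRaw ∘ bc` is the route's `incl` (forget the `ℚ`-structure) on the nose. [folklore] -/
theorem toRaw_comp_bc :
    KZOver.toRaw.comp bc =
      FreeAbelianGroup.map (fun x : (Σ n, KZ.IntegralRep n) => (⟨x.1, (x.2.domain, x.2.integrand)⟩ :
        Σ n : ℕ, Set (Fin n → ℝ) × ((Fin n → ℝ) → ℝ))) := by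
  refine FreeAbelianGroup.lift_ext _ _ fun ⟨n, r⟩ => ?_
  simp only [AddMonoidHom.coe_comp, Function.comp_apply]
  change KZOver.toRaw (bc (KZ.of r)) = _
  rw [bc_of, KZOver.toRaw_of]
  rfl

theorem toRaw_bc (c : KZ.FormalRep) :
    KZOver.toRaw (bc c) =
      FreeAbelianGroup.map (fun x : (Σ n, KZ.IntegralRep n) => (⟨x.1, (x.2.domain, x.2.integrand)⟩ :
        Σ n : ℕ, Set (Fin n → ℝ) × ((Fin n → ℝ) → ℝ))) c :=
  DFunLike.congr_fun toRaw_comp_bc c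

/-- Membership in the real relations, read in the raw encoding of the route file. [folklore] -/
theorem bc_mem_relations_iff_raw (c : KZ.FormalRep) :
    bc c ∈ KZOver.relations ℝ ↔
      FreeAbelianGroup.map (fun x : (Σ n, KZ.IntegralRep n) => (⟨x.1, (x.2.domain, x.2.integrand)⟩ :
        Σ n : ℕ, Set (Fin n → ℝ) × ((Fin n → ℝ) → ℝ))) c ∈ KZOver.Raw.Rel := by
  rw [KZOver.mem_relations_iff_toRaw_mem, toRaw_bc]

/-! ### Piece 1 is `KZ.PiLocalKernel` (tree dictionary) -/

/-- This route's copy of item 0541 is route AyoubSpecialisation's, on the nose. [folklore] -/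
theorem ayoubPiLocalKernel_iff_ayoubSpecialisation :
    AyoubPiLocalKernel ↔ AyoubSpecialisation.AyoubPiLocalKernel :=
  Iff.rfl

/-- Item 0541 as filed is `KZ.PiLocalKernel`. [folklore] -/
theorem ayoubPiLocalKernel_iff_piLocalKernel : AyoubPiLocalKernel ↔ KZ.PiLocalKernel :=
  Summit.KontsevichZagierPeriods.KernelForm.LocaliseAtValuePrime.ayoubPiLocalKernel_iff_piLocalKernel

/-! ### Piece 2: closed typing (the item) versus pinned interface typing -/

/-- For a pinned family `P`, the real base changes of `lift (of ∘ P) c` and of `[π] * c` differ by a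
real relation (base change of `BetaCancellationLine.piRep_mul_sub_lift_mem_relations`). [folklore] -/
theorem bc_lift_mem_iff
    (P : ∀ n : ℕ, KZ.IntegralRep n → KZ.IntegralRep (n + 2))
    (hP : ∀ (n : ℕ) (r : KZ.IntegralRep n),
      (P n r).domain = {z : Fin (n + 2) → ℝ | z 0 ^ 2 + z 1 ^ 2 ≤ 1 ∧ (fun i : Fin n => z i.succ.succ) ∈ r.domain} ∧
      (P n r).integrand = fun z => r.integrand (fun i : Fin n => z i.succ.succ))
    (c : KZ.FormalRep) :
    bc (FreeAbelianGroup.lift (fun s : (Σ n, KZ.IntegralRep n) => KZ.of (P s.1 s.2)) c) ∈ KZOver.relations ℝ ↔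
      bc (KZ.of KZ.piRep * c) ∈ KZOver.relations ℝ := by
  have h := bc_mem_relations
    (Summit.KontsevichZagierPeriods.KontsevichZagierPeriods.BetaCancellationLine.piRep_mul_sub_lift_mem_relations P hP c)
  rw [map_sub] at h
  constructor
  · intro hc
    simpa using (KZOver.relations ℝ).add_mem h hc
  · intro hc
    simpa using (KZOver.relations ℝ).sub_mem hc h

/-- The item (closed typing, `[π] * c`) is the pinned-typing statement. [folklore] -/
theorem realPiCancellation_iff_pinned : RealPiCancellation ↔ RealPiCancellationPinned := by
  constructor
  · intro h P hP c hc
    exact h c ((bc_lift_mem_iff P hP c).1 hc)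
  · intro h c hc
    obtain ⟨P, hP⟩ := Summit.KontsevichZagierPeriods.KontsevichZagierPeriods.BetaCancellationLine.exists_pinned
    exact h P hP c ((bc_lift_mem_iff P hP c).2 hc)

/-! ### `RealKZ` is its real kernel form -/

/-- Kernel form ⇒ `RealKZ` (take `c = [r] − [r']`; the inline `let`-calculus of `RealKZ` is
`KZOver.Raw.Rel`, comparison lemma `KZOver.Raw.gen_sub_gen_mem_Rel_iff_kz`). [folklore] -/
theorem realKZ_of_realKernelForm (hK : RealKernelForm) : DefinableMoves.RealKZ := by
  unfold DefinableMoves.RealKZ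
  intro Adm o Rel incl n m r r' _ _ hv
  rw [map_sub]
  change KZOver.Raw.gen n r.domain r.integrand - KZOver.Raw.gen m r'.domain r'.integrand ∈
    KZOver.Raw.Rel
  rw [KZOver.Raw.gen_sub_gen_mem_Rel_iff_kz, KZOver.Equivalent]
  have h := hK (KZ.of r - KZ.of r') (by rw [KZ.eval_of_sub_of, hv, sub_self])
  rw [map_sub, map_sub] at h
  exact h

/-- `RealKZ` ⇒ kernel form: `c ≡ [r] − [r']` modulo `ℚ`-moves (`KZ.exists_integralRep_sub`), `r`,
`r'` are equivalent to rational-shape `R`, `R'` (`KZ.exists_isRational_equivalent`), soundness makes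
the values agree, `RealKZ` joins `R` to `R'` over `ℝ`, and the `ℚ`-relations are base-changed.
[folklore] -/
theorem realKernelForm_of_realKZ (hR : DefinableMoves.RealKZ) : RealKernelForm := by
  intro c hc
  obtain ⟨n, m, r, r', hrel⟩ := KZ.exists_integralRep_sub_holds c
  obtain ⟨N, R, hRrat, hrR⟩ := KZ.exists_isRational_equivalent_holds r
  obtain ⟨N', R', hR'rat, hrR'⟩ := KZ.exists_isRational_equivalent_holds r'
  have hv : r.value = r'.value := by
    have hker : KZ.eval (c - (KZ.of r - KZ.of r')) = 0 := KZ.relations_le_ker_eval_holds hrel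
    rwa [map_sub, hc, zero_sub, neg_eq_zero, KZ.eval_of_sub_of, sub_eq_zero] at hker
  have hvR : R.value = R'.value := by
    rw [← KZ.Equivalent.value_eq_holds hrR, ← KZ.Equivalent.value_eq_holds hrR', hv]
  -- `RealKZ` over `ℝ` for the rational-shape pair
  have hRR' : KZOver.Equivalent (KZOver.IntegralRep.ofKZOver ℝ R) (KZOver.IntegralRep.ofKZOver ℝ R') := by
    rw [← KZOver.Raw.gen_sub_gen_mem_Rel_iff_kz]
    have h0 := hR R R' hRrat hR'rat hvR
    rw [map_sub] at h0
    exact h0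
  have h3 : bc (KZ.of R - KZ.of R') ∈ KZOver.relations ℝ := by
    rw [map_sub, bc_of, bc_of]; exact hRR'
  have h1 : bc (c - (KZ.of r - KZ.of r')) ∈ KZOver.relations ℝ := bc_mem_relations hrel
  have h2 : bc (KZ.of r - KZ.of R) ∈ KZOver.relations ℝ := bc_mem_relations hrR
  have h4 : bc (KZ.of r' - KZ.of R') ∈ KZOver.relations ℝ := bc_mem_relations hrR'
  have e : c = (c - (KZ.of r - KZ.of r')) + (KZ.of r - KZ.of R) + (KZ.of R - KZ.of R') -
      (KZ.of r' - KZ.of R') := by abel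
  show bc c ∈ KZOver.relations ℝ
  rw [e, map_sub, map_add, map_add]
  exact (KZOver.relations ℝ).sub_mem ((KZOver.relations ℝ).add_mem
    ((KZOver.relations ℝ).add_mem h1 h2) h3) h4

/-- **`RealKZ ↔ RealKernelForm`.** [folklore] -/
theorem realKZ_iff_realKernelForm : DefinableMoves.RealKZ ↔ RealKernelForm :=
  ⟨realKernelForm_of_realKZ, realKZ_of_realKernelForm⟩

/-! ### The assembly: peel the powers of `[π]` over `ℝ` -/

/-- Peeling: if the real base change of `([π] * ·)^[N] d` is a real relation, so is that of `d`,
by `N` applications of real `π`-cancellation. [folklore] -/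
theorem bc_mem_of_iterate (h₂ : RealPiCancellation) :
    ∀ (N : ℕ) (d : KZ.FormalRep),
      bc ((fun x => KZ.of KZ.piRep * x)^[N] d) ∈ KZOver.relations ℝ → bc d ∈ KZOver.relations ℝ := by
  intro N
  induction N with
  | zero => intro d h; simpa using h
  | succ N ih =>
      intro d h
      rw [Function.iterate_succ_apply'] at h
      exact ih d (h₂ _ h)

/-- `π`-local kernel over `ℚ` + real `π`-cancellation ⇒ the real kernel form. [folklore] -/
theorem realKernelForm_of_piLocalKernel (h₁ : KZ.PiLocalKernel) (h₂ : RealPiCancellation) :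
    RealKernelForm := by
  intro c hc
  obtain ⟨N, hN⟩ := h₁ c hc
  exact bc_mem_of_iterate h₂ N c (bc_mem_relations hN)

/-- **THE SPLIT GLUE** (assembly of the decomposition of crux stmt-KontsevichZagierPeriods-4085):
`AyoubPiLocalKernel → RealPiCancellation → RealKZ`. [folklore] -/
theorem realKZ_of_piSplit (h₁ : AyoubPiLocalKernel) (h₂ : RealPiCancellation) : DefinableMoves.RealKZ :=
  realKZ_of_realKernelForm
    (realKernelForm_of_piLocalKernel (ayoubPiLocalKernel_iff_piLocalKernel.mp h₁) h₂)

/-! ### Calibration: `RealKZ ⇒ RealPiCancellation` -/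

/-- Real `π`-cancellation certificates already force the value to vanish. [folklore] -/
theorem eval_eq_zero_of_bc_piRep_mul {c : KZ.FormalRep}
    (hc : bc (KZ.of KZ.piRep * c) ∈ KZOver.relations ℝ) : KZ.eval c = 0 := by
  have h := KZOver.eval_eq_zero_of_mem_relations hc
  rw [eval_bc, KZ.eval_piRep_mul] at h
  exact (mul_eq_zero.mp h).resolve_left Real.pi_ne_zero

/-- The real kernel form implies real `π`-cancellation. [folklore] -/
theorem realPiCancellation_of_realKernelForm (hK : RealKernelForm) : RealPiCancellation :=
  fun c hc => hK c (eval_eq_zero_of_bc_piRep_mul hc)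

/-- **`RealKZ ⇒ RealPiCancellation`** (so the split is exact modulo `RealKZ ⇒ 0541`, which is the
transcendence content). [folklore] -/
theorem realPiCancellation_of_realKZ (hR : DefinableMoves.RealKZ) : RealPiCancellation :=
  realPiCancellation_of_realKernelForm (realKernelForm_of_realKZ hR)

/-- The two implications of the split over `ℝ` in one statement. [folklore] -/
theorem realKZ_of_pieces_and_back :
    (AyoubPiLocalKernel ∧ RealPiCancellation → DefinableMoves.RealKZ) ∧
      (DefinableMoves.RealKZ → RealPiCancellation) :=
  ⟨fun h => realKZ_of_piSplit h.1 h.2, realPiCancellation_of_realKZ⟩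

/-! ### Calibration against item 4088 `Transfer`: given Transfer, piece 2 is exactly `KZ.PiCancellation` -/

/-- `Transfer` (item 4088, let-form) read on `bc`: a `ℚ`-combination whose real base change is a
real relation is a `ℚ`-relation. [folklore] -/
theorem transfer_bc (hT : DefinableMoves.Transfer) {c : KZ.FormalRep}
    (hc : bc c ∈ KZOver.relations ℝ) : c ∈ KZ.relations := by
  rw [bc_mem_relations_iff_raw] at hc
  exact hT c hc

theorem realPiCancellation_of_transfer_of_piCancellation (hT : DefinableMoves.Transfer)
    (hC : KZ.PiCancellation) : RealPiCancellation := by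
  intro c hc
  exact bc_mem_relations (hC c (transfer_bc hT hc))

theorem piCancellation_of_transfer_of_realPiCancellation (hT : DefinableMoves.Transfer)
    (hR : RealPiCancellation) : KZ.PiCancellation := by
  intro c hc
  exact transfer_bc hT (hR c (bc_mem_relations hc))

/-- Given `Transfer`, real `π`-cancellation is `π`-cancellation `KZ.PiCancellation`. [folklore] -/
theorem realPiCancellation_iff_piCancellation_of_transfer (hT : DefinableMoves.Transfer) :
    RealPiCancellation ↔ KZ.PiCancellation :=
  ⟨piCancellation_of_transfer_of_realPiCancellation hT,
    realPiCancellation_of_transfer_of_piCancellation hT⟩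

/-- Given `Transfer`, the item is item 0540 AS FILED (`AyoubSpecialisation.AyoubPiCancellation`, via the
tree dictionary `BetaCancellationLine.stub_ayoubBridge`). [folklore] -/
theorem realPiCancellation_iff_ayoubPiCancellation_of_transfer (hT : DefinableMoves.Transfer) :
    RealPiCancellation ↔ AyoubSpecialisation.AyoubPiCancellation :=
  (realPiCancellation_iff_piCancellation_of_transfer hT).trans
    Summit.KontsevichZagierPeriods.KontsevichZagierPeriods.BetaCancellationLine.stub_ayoubBridge.symm

/-- Given `Transfer`, the real kernel form is the kernel conjecture. [folklore] -/
theorem realKernelForm_iff_kernel_of_transfer (hT : DefinableMoves.Transfer) :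
    RealKernelForm ↔ KZKernelConjecture :=
  ⟨fun hK c hc => transfer_bc hT (hK c hc), fun hk c hc => bc_mem_relations (hk c hc)⟩

/-! ### The pieces are consequences of the summit (kept OUT of the Theorems copy) -/

/-- The summit in kernel form. [folklore] -/
theorem kernel_of_summit (h : _root_.KontsevichZagierPeriods) : KZKernelConjecture :=
  kzKernelConjecture_iff_isRational.mpr h

theorem realKernelForm_of_summit (h : _root_.KontsevichZagierPeriods) : RealKernelForm :=
  fun c hc => bc_mem_relations (kernel_of_summit h c hc)

/-- summit ⇒ RealKZ (unconditionally; the converse needs `Transfer`). [folklore] -/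
theorem realKZ_of_summit (h : _root_.KontsevichZagierPeriods) : DefinableMoves.RealKZ :=
  realKZ_of_realKernelForm (realKernelForm_of_summit h)

/-- summit ⇒ piece 1. [folklore] -/
theorem ayoubPiLocalKernel_of_summit (h : _root_.KontsevichZagierPeriods) : AyoubPiLocalKernel :=
  ayoubPiLocalKernel_iff_piLocalKernel.mpr (KZ.piLocalKernel_of_kernel (kernel_of_summit h))

/-- summit ⇒ piece 2. [folklore] -/
theorem realPiCancellation_of_summit (h : _root_.KontsevichZagierPeriods) : RealPiCancellation :=
  realPiCancellation_of_realKernelForm (realKernelForm_of_summit h)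

/-- GIVEN `Transfer`, the crux is the summit (the auditor's "equivalent by Transfer", as a theorem). [folklore] -/
theorem realKZ_iff_summit_of_transfer (hT : DefinableMoves.Transfer) :
    DefinableMoves.RealKZ ↔ _root_.KontsevichZagierPeriods :=
  ⟨fun hR => kzKernelConjecture_iff_isRational.mp
      ((realKernelForm_iff_kernel_of_transfer hT).mp (realKernelForm_of_realKZ hR)),
    realKZ_of_summit⟩

end Summit.KontsevichZagierPeriods.KontsevichZagierPeriods.Cruxes.RealKZ.PiSplit

end
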